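import Literature.AlgebraicGeometry.Frobenioids.BirationalNormalizationExampleClauses
import HarnessLib

/-!
# Frobenioids I, Example 4.6: `C` is a Frobenioid of isotropic and standard type, not of group-like
# type — part 3 (clauses (iv)–(vii) of Definition 1.3, assembly, types)

Mochizuki, *The geometry of Frobenioids I: the general theory*, Kyushu J. Math. **62** (2008)
293–400, kurims text p. 87 [cite: MochizukiFrdI2008, Ex. 4.6 p.87]:
"Moreover, one checks immediately that, relative to this last functor, `C` is a Frobenioid of isotropic
and standard type which is not of group-like type." PROOF-ONLY; concludes the chain
`BirationalNormalizationExampleMorphisms.lean` → `…Clauses.lean` (seat abc-iut-L1-t8).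

PROVED: Def. 1.3 (iv) (factorization `φ = id ∘ (g, a, b, 1) ∘ (0, 0, 0, d)`, unique since every arrow is
epi), (v) (pre-steps are mono; isometric pre-steps are isomorphisms), (vi) (unit `(g − g', 0, 0, 1)`), (vii)
(every object isotropic); **`Ex46.isFrobenioid`**; every object Frobenius-normalized
(`isFrobeniusNormalized`: `α^d ∘ φ = φ ∘ α` as `d · g` commutes past the twist, `Ξ` only entering through
`a(α) = 0`); `isOfIsotropicType`, `not_isOfType_isGroupLikeObj` (`Φ ≠ 0`), and **`isOfStandardType`** (Def. 3.1
(i) in seat abc-iut-L1-t3's operations form: (a) via Rem. 3.1.1, (b) vacuous, (c), (d) one-morphism base is of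
FSMFF-type, (e) identity pull-backs are non-dilating). The birational claims of Ex. 4.6 (`O^×(A^birat) = M₀`,
"not of birationally Frobenius-normalized type if some `ξ_p ≠ 0`") are the subject of the sequel.
No statement of the paper is strengthened; nothing here takes a side on [IUTchIII] Cor. 3.12.
-/

namespace Literature.AlgebraicGeometry.Frobenioids

open CategoryTheory Opposite

namespace Ex46

open PreFrobenioid

variable {G : Type} [AddCommGroup G] (P : Datum G)

/-! ### Definition 1.3 (iv) -/

/-- (iv)(a), existence: `φ = (g, a, b, d) : A_n → A_m` factors as `id ∘ (g, a, b, 1) ∘ (0, 0, 0, d)` through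
`A_{dn}`. [cite: MochizukiFrdI2008, Def. 1.3(iv) p.25] -/
theorem iv_a_exists {A B : Obj P} (φ : A ⟶ B) :
    ∃ (X Y : Obj P) (γ : A ⟶ X) (β : X ⟶ Y) (α : Y ⟶ B), γ ≫ β ≫ α = φ ∧
      IsFrobeniusType (toElem P) γ ∧ IsPreStep (toElem P) β ∧ IsPullbackMorphism (toElem P) α := by
  let X : Obj P := ⟨((val P φ).d : ℤ) * A.idx⟩
  obtain ⟨γ, hγ⟩ := exists_hom P A X 0 0 0 (val P φ).d le_rfl le_rfl (by simp [X])
  obtain ⟨β, hβ⟩ := exists_hom P X B (val P φ).μ.1 (val P φ).a (val P φ).b 1 (a_nonneg P φ) (b_nonneg P φ)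
    (by rw [PNat.one_coe, Nat.cast_one, one_mul]; exact idx_eq P φ)
  refine ⟨X, B, γ, β, 𝟙 B, ?_, (isFrobeniusType_iff P γ).mpr (by rw [hγ]; exact ⟨rfl, rfl⟩),
    (isPreStep_iff P β).mpr (by rw [hβ]), isPullbackMorphism_of_isIso (toElem P) _⟩
  rw [Category.comp_id]
  apply hom_ext P
  rw [val_comp, hβ, hγ]
  refine N.ext ?_ ?_
  · rw [N.mul_μ]
    show (val P φ).μ + P.α 1 (0 : Mmod G) = (val P φ).μ
    rw [map_zero, add_zero]
  · exact one_mul _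

/-- (iv)(a), uniqueness: two factorizations differ by `(ε, δ)` — `ε` from (ii) (same degree, same source),
`δ = α ∘ α'⁻¹` (pull-backs are isomorphisms), and the middle square since `γ` is epi.
[cite: MochizukiFrdI2008, Def. 1.3(iv) p.25] -/
theorem iv_a_unique {A B X Y X' Y' : Obj P} (φ : A ⟶ B) (γ : A ⟶ X) (β : X ⟶ Y) (α : Y ⟶ B)
    (γ' : A ⟶ X') (β' : X' ⟶ Y') (α' : Y' ⟶ B)
    (h : γ ≫ β ≫ α = φ) (hγ : IsFrobeniusType (toElem P) γ) (hβ : IsPreStep (toElem P) β)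
    (hα : IsPullbackMorphism (toElem P) α)
    (h' : γ' ≫ β' ≫ α' = φ) (hγ' : IsFrobeniusType (toElem P) γ') (hβ' : IsPreStep (toElem P) β')
    (hα' : IsPullbackMorphism (toElem P) α') :
    ∃ (ε : X ≅ X') (δ : Y ≅ Y'), γ ≫ ε.hom = γ' ∧ β ≫ δ.hom = ε.hom ≫ β' ∧ α = δ.hom ≫ α' := by
  haveI hαi : IsIso α := (isPullbackMorphism_iff P α).mp hα
  haveI hαi' : IsIso α' := (isPullbackMorphism_iff P α').mp hα'
  have hdα : (val P α).d = 1 := ((isIso_iff P α).mp hαi).1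
  have hdα' : (val P α').d = 1 := ((isIso_iff P α').mp hαi').1
  have hdβ : (val P β).d = 1 := (isPreStep_iff P β).mp hβ
  have hdβ' : (val P β').d = 1 := (isPreStep_iff P β').mp hβ'
  have hd : degFr (toElem P) γ = degFr (toElem P) γ' := by
    have e1 := congrArg (fun f : A ⟶ B => (val P f).d) h
    have e2 := congrArg (fun f : A ⟶ B => (val P f).d) h'
    simp only [comp_d, hdα, hdβ, hdα', hdβ', one_mul] at e1 e2
    exact e1.trans e2.symm
  obtain ⟨ε, hε⟩ := ii_unique P γ γ' hγ hγ' hd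
  refine ⟨ε, asIso α ≪≫ (asIso α').symm, hε, ?_, ?_⟩
  · haveI := epi P γ
    rw [← cancel_epi γ]
    show γ ≫ β ≫ (α ≫ inv α') = γ ≫ ε.hom ≫ β'
    have e1 : γ ≫ β ≫ (α ≫ inv α') = φ ≫ inv α' := by
      rw [← h]; simp only [Category.assoc]
    have e2 : γ ≫ ε.hom ≫ β' = φ ≫ inv α' := by
      rw [← Category.assoc, hε, ← h']; simp only [Category.assoc, IsIso.hom_inv_id, Category.comp_id]
    rw [e1, e2]
  · show α = (α ≫ inv α') ≫ α'
    rw [Category.assoc, IsIso.inv_hom_id, Category.comp_id]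

/-- (iv)(b): pull-back morphisms (= isomorphisms) are LB-invertible and linear. [cite: MochizukiFrdI2008, Def. 1.3(iv) p.25] -/
theorem iv_b {A B : Obj P} (φ : A ⟶ B) (hφ : IsPullbackMorphism (toElem P) φ) :
    IsLBInvertible (toElem P) φ ∧ IsLinear (toElem P) φ := by
  obtain ⟨hd, ha, hb⟩ := (isIso_iff P φ).mp ((isPullbackMorphism_iff P φ).mp hφ)
  exact ⟨⟨isCoAngular P φ, (isIsometry_iff P φ).mpr ⟨ha, hb⟩⟩, hd⟩

/-! ### Definition 1.3 (v) -/

/-- (v)(a): pre-steps are monomorphisms. [cite: MochizukiFrdI2008, Def. 1.3(v) p.25] -/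
theorem v_a {A B : Obj P} (φ : A ⟶ B) (hφ : IsPreStep (toElem P) φ) : Mono φ :=
  mono_of_d_eq_one P φ ((isPreStep_iff P φ).mp hφ)

/-- (v)(b), existence: `φ = id ∘ φ`. [cite: MochizukiFrdI2008, Def. 1.3(v) p.25] -/
theorem v_b_exists {A B : Obj P} (φ : A ⟶ B) (hφ : IsPreStep (toElem P) φ) :
    ∃ (X : Obj P) (β : A ⟶ X) (α : X ⟶ B), β ≫ α = φ ∧ IsCoAngularPreStep (toElem P) β ∧
      (IsIsometry (toElem P) α ∧ IsPreStep (toElem P) α) :=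
  ⟨B, φ, 𝟙 B, Category.comp_id φ, ⟨isCoAngular P φ, hφ⟩, (isIsometry_iff P _).mpr ⟨rfl, rfl⟩,
    (isPreStep_iff P _).mpr rfl⟩

/-- (v)(b), uniqueness: the isometric pre-steps `α`, `α'` are isomorphisms; `γ = α ∘ α'⁻¹`.
[cite: MochizukiFrdI2008, Def. 1.3(v) p.25] -/
theorem v_b_unique {A B X X' : Obj P} (φ : A ⟶ B) (β : A ⟶ X) (α : X ⟶ B) (β' : A ⟶ X') (α' : X' ⟶ B)
    (h : β ≫ α = φ) (_hβ : IsCoAngularPreStep (toElem P) β) (hα : IsIsometry (toElem P) α ∧ IsPreStep (toElem P) α)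
    (h' : β' ≫ α' = φ) (_hβ' : IsCoAngularPreStep (toElem P) β')
    (hα' : IsIsometry (toElem P) α' ∧ IsPreStep (toElem P) α') :
    ∃ γ : X ≅ X', β ≫ γ.hom = β' ∧ α = γ.hom ≫ α' := by
  haveI := isIso_of_isIsometry_of_isPreStep P α hα.1 hα.2
  haveI := isIso_of_isIsometry_of_isPreStep P α' hα'.1 hα'.2
  refine ⟨asIso α ≪≫ (asIso α').symm, ?_, ?_⟩
  · show β ≫ α ≫ inv α' = β'
    rw [← Category.assoc, h, ← h', Category.assoc, IsIso.hom_inv_id, Category.comp_id]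
  · show α = (α ≫ inv α') ≫ α'
    rw [Category.assoc, IsIso.inv_hom_id, Category.comp_id]

/-- (v)(c), existence: `φ = φ ∘ id`. [cite: MochizukiFrdI2008, Def. 1.3(v) p.25] -/
theorem v_c_exists {A B : Obj P} (φ : A ⟶ B) (hφ : IsPreStep (toElem P) φ) :
    ∃ (X : Obj P) (β' : A ⟶ X) (α' : X ⟶ B), β' ≫ α' = φ ∧
      (IsIsometry (toElem P) β' ∧ IsPreStep (toElem P) β') ∧ IsCoAngularPreStep (toElem P) α' :=
  ⟨A, 𝟙 A, φ, Category.id_comp φ, ⟨(isIsometry_iff P _).mpr ⟨rfl, rfl⟩, (isPreStep_iff P _).mpr rfl⟩,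
    ⟨isCoAngular P φ, hφ⟩⟩

/-- (v)(c), uniqueness: `γ = β⁻¹ ∘ β'`. [cite: MochizukiFrdI2008, Def. 1.3(v) p.25] -/
theorem v_c_unique {A B X X' : Obj P} (φ : A ⟶ B) (β : A ⟶ X) (α : X ⟶ B) (β' : A ⟶ X') (α' : X' ⟶ B)
    (h : β ≫ α = φ) (hβ : IsIsometry (toElem P) β ∧ IsPreStep (toElem P) β) (_hα : IsCoAngularPreStep (toElem P) α)
    (h' : β' ≫ α' = φ) (hβ' : IsIsometry (toElem P) β' ∧ IsPreStep (toElem P) β')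
    (_hα' : IsCoAngularPreStep (toElem P) α') :
    ∃ γ : X ≅ X', β ≫ γ.hom = β' ∧ α = γ.hom ≫ α' := by
  haveI := isIso_of_isIsometry_of_isPreStep P β hβ.1 hβ.2
  haveI := isIso_of_isIsometry_of_isPreStep P β' hβ'.1 hβ'.2
  refine ⟨(asIso β).symm ≪≫ asIso β', ?_, ?_⟩
  · show β ≫ inv β ≫ β' = β'
    rw [IsIso.hom_inv_id_assoc]
  · show α = (inv β ≫ β') ≫ α'
    rw [Category.assoc, h', ← h, IsIso.inv_hom_id_assoc]

/-! ### Definition 1.3 (vi), (vii) -/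

/-- Metric equivalence means equal `(a, b)`. [cite: MochizukiFrdI2008, Def. 1.3(vi) p.25] -/
theorem ab_eq_of_metricallyEquivalent {A B : Obj P} {φ ψ : A ⟶ B} (h : MetricallyEquivalent (toElem P) φ ψ) :
    (val P φ).a = (val P ψ).a ∧ (val P φ).b = (val P ψ).b := by
  have h' := congrArg Multiplicative.toAdd h
  change ((val P φ).a.toNat, (val P φ).b.toNat) = ((val P ψ).a.toNat, (val P ψ).b.toNat) at h'
  obtain ⟨h1, h2⟩ := Prod.mk.injEq _ _ _ _ ▸ h'
  constructor
  · rw [← Int.toNat_of_nonneg (a_nonneg P φ), ← Int.toNat_of_nonneg (a_nonneg P ψ), h1]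
  · rw [← Int.toNat_of_nonneg (b_nonneg P φ), ← Int.toNat_of_nonneg (b_nonneg P ψ), h2]

/-- (vi): metrically equivalent co-angular pre-steps `φ, ψ : A → B` differ by the unit `(g(φ) − g(ψ), 0, 0, 1)`
of `B`. [cite: MochizukiFrdI2008, Def. 1.3(vi) p.25] -/
theorem vi {A B : Obj P} (φ ψ : A ⟶ B) (hφ : IsCoAngularPreStep (toElem P) φ) (hψ : IsCoAngularPreStep (toElem P) ψ)
    (_hb : BaseEquivalent (toElem P) φ ψ) (hm : MetricallyEquivalent (toElem P) φ ψ) :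
    ∃ α ∈ unitsSubgroup (toElem P) B, ψ ≫ α.hom = φ := by
  have hdφ : (val P φ).d = 1 := (isCoAngularPreStep_iff P φ).mp hφ
  have hdψ : (val P ψ).d = 1 := (isCoAngularPreStep_iff P ψ).mp hψ
  obtain ⟨ha, hb⟩ := ab_eq_of_metricallyEquivalent P hm
  have hB : B.idx - (((1 : ℕ+) : ℕ) : ℤ) * B.idx = 0 + 0 := by simp
  obtain ⟨e, he⟩ := exists_hom P B B ((val P φ).μ.1 - (val P ψ).μ.1) 0 0 1 le_rfl le_rfl hB
  haveI : IsIso e := (isIso_iff P e).mpr (by rw [he]; exact ⟨rfl, rfl, rfl⟩)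
  refine ⟨asIso e, ⟨isBaseIdentity P _, show (val P e).d = 1 by rw [he]⟩, hom_ext P ?_⟩
  rw [asIso_hom, val_comp, he]
  refine N.ext (Prod.ext ?_ (Prod.ext ?_ ?_)) ?_
  · rw [N.mul_μ, Datum.α_apply]
    show (val P φ).μ.1 - (val P ψ).μ.1 + ((((1 : ℕ+) : ℕ) : ℤ) • (val P ψ).μ.1 + (val P ψ).a • P.Ξ 1) = (val P φ).μ.1
    rw [Datum.Ξ_one, smul_zero, add_zero, PNat.one_coe, Nat.cast_one, one_smul]
    abel
  · show (0 : ℤ) + (((1 : ℕ+) : ℕ) : ℤ) * (val P ψ).a = (val P φ).a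
    rw [PNat.one_coe, Nat.cast_one, one_mul, zero_add, ha]
  · show (0 : ℤ) + (((1 : ℕ+) : ℕ) : ℤ) * (val P ψ).b = (val P φ).b
    rw [PNat.one_coe, Nat.cast_one, one_mul, zero_add, hb]
  · show 1 * (val P ψ).d = (val P φ).d
    rw [hdψ, hdφ, one_mul]

/-- (vii)(a): the identity is an isotropic hull (all objects are isotropic). [cite: MochizukiFrdI2008, Def. 1.3(vii) p.25] -/
theorem vii_a (A : Obj P) : ∃ (B : Obj P) (φ : A ⟶ B), IsIsotropicHull (toElem P) φ :=
  ⟨A, 𝟙 A, (isIsometry_iff P _).mpr ⟨rfl, rfl⟩, (isPreStep_iff P _).mpr rfl, isIsotropic P A,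
    fun _ γ _ => ⟨γ, Category.id_comp γ, fun β hβ => (Category.id_comp β).symm.trans hβ⟩⟩

/-- (vii)(b): all objects are isotropic. [cite: MochizukiFrdI2008, Def. 1.3(vii) p.25] -/
theorem vii_b {A B : Obj P} (_φ : A ⟶ B) (_hA : IsIsotropic (toElem P) A) : IsIsotropic (toElem P) B :=
  isIsotropic P B

/-! ### `C` is a Frobenioid -/

/-- **Example 4.6: "relative to this last functor, `C` is a Frobenioid"** (FrdI p. 87; all of Def. 1.3
verified). [cite: MochizukiFrdI2008, Ex. 4.6 p.87] -/
theorem isFrobenioid : IsFrobenioid (toElem P) where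
  isPreFrobenioid := isPreFrobenioid P
  i_a := i_a P
  i_b := i_b P
  i_c := i_c P
  ii_exists := ii_exists P
  ii_unique := fun _ _ _ φ ψ hφ hψ hn => ii_unique P φ ψ hφ hψ hn
  iii_a := fun _ _ _ f g hf hg => iii_a P f g hf hg
  iii_b := fun _ _ φ h ψ => iii_b P φ h ψ
  iii_c := fun _ _ φ h => iii_c P φ h
  iii_c_base := fun _ _ φ φ' h h' hb α β β' e₁ e₂ => iii_c_base P φ φ' h h' hb α β β' e₁ e₂
  iii_d_under_full := fun _ _ _ φ φ' h h' hd => iii_d_under_full P φ φ' h h' hd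
  iii_d_under_surj := iii_d_under_surj P
  iii_d_over_full := fun _ _ _ ψ ψ' h h' hd => iii_d_over_full P ψ ψ' h h' hd
  iii_d_over_surj := iii_d_over_surj P
  iv_a_exists := fun _ _ φ => iv_a_exists P φ
  iv_a_unique := fun _ _ _ _ _ _ φ γ β α γ' β' α' h hγ hβ hα h' hγ' hβ' hα' =>
    iv_a_unique P φ γ β α γ' β' α' h hγ hβ hα h' hγ' hβ' hα'
  iv_b := fun _ _ φ h => iv_b P φ h
  v_a := fun _ _ φ h => v_a P φ h
  v_b_exists := fun _ _ φ h => v_b_exists P φ h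
  v_b_unique := fun _ _ _ _ φ β α β' α' e hβ hα e' hβ' hα' => v_b_unique P φ β α β' α' e hβ hα e' hβ' hα'
  v_c_exists := fun _ _ φ h => v_c_exists P φ h
  v_c_unique := fun _ _ _ _ φ β α β' α' e hβ hα e' hβ' hα' => v_c_unique P φ β α β' α' e hβ hα e' hβ' hα'
  vi := fun _ _ φ ψ hφ hψ hb hm => vi P φ ψ hφ hψ hb hm
  vii_a := vii_a P
  vii_b := fun _ _ φ h => vii_b P φ h

/-! ### Types: isotropic, not group-like, Frobenius-normalized, standard -/

/-- **Example 4.6**: "`C` is … of isotropic … type". [cite: MochizukiFrdI2008, Ex. 4.6 p.87] -/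
theorem isOfIsotropicType : IsOfIsotropicType (toElem P) := fun A => isIsotropic P A

/-- **Example 4.6**: "… which is not of group-like type" (`Φ = ℤ_{≥0}² ≠ 0`). [cite: MochizukiFrdI2008, Ex. 4.6 p.87] -/
theorem not_isOfType_isGroupLikeObj : ¬ IsOfType (IsGroupLikeObj (toElem P)) := by
  intro h
  have h1 : (Multiplicative.ofAdd (((1 : ℕ), (0 : ℕ))) : Multiplicative (ℕ × ℕ)) = 1 := h (A₀ P) _
  have h2 := congrArg (fun x : Multiplicative (ℕ × ℕ) => (Multiplicative.toAdd x).1) h1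
  simp at h2

/-- Powers in `O^▷(A)`: `g(αⁿ) = n · g(α)`. [cite: MochizukiFrdI2008, Ex. 4.6 p.87] -/
theorem g_pow_of_mem {X : Obj P} {α : End X} (hα : α ∈ endSubmonoid (toElem P) X) (n : ℕ) :
    (val P (α ^ n)).μ.1 = n • (val P α).μ.1 := by
  induction n with
  | zero => rw [pow_zero, zero_nsmul]; rfl
  | succ n ih => rw [pow_succ, g_mul_of_mem P (pow_mem hα n) hα, ih, succ_nsmul]

/-- **Example 4.6**: every object of `C` is Frobenius-normalized — for a base-identity `φ = (g, a, b, d) ∈ End(A_n)`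
and `α = (h, 0, 0, 1) ∈ O^▷(A_n)`: `α^d ∘ φ = (d h + g, a, b, d) = φ ∘ α` (the twist `a(α) · Ξ(d)` vanishes as
`a(α) = 0`). [cite: MochizukiFrdI2008, Ex. 4.6 p.87] -/
theorem isFrobeniusNormalized (A : Obj P) : IsFrobeniusNormalized (toElem P) A := by
  intro φ _ α hα
  have hαv := val_eq_of_mem_endSubmonoid P hα
  have hpow := val_eq_of_mem_endSubmonoid P (pow_mem hα (degFr (toElem P) φ : ℕ))
  rw [g_pow_of_mem P hα] at hpow
  apply hom_ext P
  change val P (α ^ (degFr (toElem P) φ : ℕ)) * val P φ = val P φ * val P α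
  rw [hpow, hαv]
  refine N.ext ?_ ?_
  · rw [N.mul_μ, N.mul_μ, Datum.α_one, AddMonoidHom.id_apply, Datum.α_apply]
    show ((((val P φ).d : ℕ) • (val P α).μ.1, (0 : ℤ), (0 : ℤ)) : Mmod G) + (val P φ).μ =
      (val P φ).μ + (((val P φ).d : ℤ) • (val P α).μ.1 + (0 : ℤ) • P.Ξ (val P φ).d, ((val P φ).d : ℤ) * 0,
        ((val P φ).d : ℤ) * 0)
    rw [zero_smul, add_zero, mul_zero, natCast_zsmul, add_comm]
  · show 1 * (val P φ).d = (val P φ).d * 1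
    rw [one_mul, mul_one]

/-- **Example 4.6**: `C` is of Frobenius-normalized type ("it is not necessarily the case that a Frobenioid of
Frobenius-normalized type is of birationally Frobenius-normalized type" — this is the Frobenius-normalized
half). [cite: MochizukiFrdI2008, Ex. 4.6 p.86] -/
theorem isOfType_isFrobeniusNormalized : IsOfType (IsFrobeniusNormalized (toElem P)) :=
  fun A => isFrobeniusNormalized P A

/-- **Example 4.6: "`C` is a Frobenioid of isotropic and standard type which is not of group-like type"** —
the standard-type clause (Def. 3.1 (i) in the operations form of seat abc-iut-L1-t3): (a) quasi-isotropic
(isotropic type + Rem. 3.1.1) and Frobenius-isotropic (identities are of Frobenius type), (b) vacuous, (c)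
`isFrobeniusNormalized`, (d) the one-morphism base is of FSMFF-type, (e) identity pull-backs are non-dilating.
[cite: MochizukiFrdI2008, Ex. 4.6 p.87] -/
theorem isOfStandardType :
    (PreFrobenioidData.ofFunctor Literature.AlgebraicGeometry.Frobenioids.Ex46.Φ (toElem P)).IsOfStandardType := by
  have hiso : (PreFrobenioidData.ofFunctor Φ (toElem P)).IsOfIsotropicType :=
    ⟨fun A => (PreFrobenioidData.ofFunctor_isIsotropic (toElem P) A).mpr (isIsotropic P A)⟩
  exact
    { quasiIsotropic := isOfQuasiIsotropicType_of_isOfIsotropicType Φ (toElem P) (isFrobenioid P) hiso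
      frobeniusIsotropic := ⟨fun A => ⟨A, 𝟙 A, by
          rw [PreFrobenioidData.ofFunctor_isFrobeniusType]
          exact (isFrobeniusType_iff P _).mpr ⟨rfl, rfl⟩, hiso.obj A⟩⟩
      frobeniusCompact_of_groupLike := fun hg =>
        (not_isOfType_isGroupLikeObj P fun A =>
          (PreFrobenioidData.ofFunctor_isGroupLikeObj (toElem P) A).mp (hg.obj A)).elim
      frobeniusNormalized := ⟨fun A => isFrobeniusNormalized P A⟩
      fsmff := StandardFrobenioidExample.isOfFSMFFType_D
      nonDilating := ⟨fun X f _ a => by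
        obtain ⟨b, rfl⟩ := Associates.mk_surjective a
        rfl⟩ }

end Ex46

end Literature.AlgebraicGeometry.Frobenioids
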